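import Literature.AnabelianGeometry.SemiGraphs.TemperedConj2OfLocallyFinite
import Literature.AnabelianGeometry.SemiGraphs.TemperedReconstructionR3cOfTwoHosts
import HarnessLib

/-!
# [SemiAnbd] Thm 3.7 (iii) / Cor 3.9 (R3c): the centraliser of a nontrivial compact subgroup of
# `π₁^temp(𝒢)` lies in each of its verticial hosts — at every LOCALLY FINITE countable `𝒢` (proof-only)

Mochizuki, *Semi-graphs of anabelioids*, Publ. RIMS **42** (2006), §3, Theorem 3.7 (iii) pp. 40–41 and
Corollary 3.9, proof p. 43 l. 13 ("[again by Theorem 3.7, (iii), (iv)]" — the step the cell names (R3c)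
`EdgeLikeCentralizerAt` / `EdgeLikeCentralizer`, FACT-LIST rows F-2772 / F-2773)
[cite: MochizukiSemiAnbd2006, Cor 3.9 p.43].

PROOF-ONLY companion (abc-iut cell, block F fact-proving wave, seat abc-iut-f-172 gen 4; no definition, no
new named fact; nothing of the custody files `TemperedReconstructionR3Sub.lean`, `TemperedVerticial.lean`,
`TemperedLevelData.lean` is altered).

WHAT IS PROVED.
* `VerticialLevelData.centralizer_le_of_hadj` — over ANY level data `D` of a chart `c` (the trees
  `𝒢_{∞,j}` with the action of `π₁^temp(𝒢)` and the identifications (I1)/(I2)), for a subgroup `C` enjoying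
  the adjacency clause `hadj` of (FIX∞) («two compatible `C`-fixed vertex systems that differ at a level are
  joined there by a `C`-fixed edge», print p. 41 "these two vertices are joined to one another by a single
  edge"): **the centraliser of `C` lies in every verticial subgroup `H ⊇ C`.**  Proof (Bass–Serre style, one
  level): `H` fixes a compatible system `y` (I1) whose stabiliser is `H` ((I2) + Thm 3.7 (ii)); for `g`
  centralising `C` the translate `g·y` is again `C`-fixed; if `g·y ≠ y` at level `i`, `hadj` joins `yᵢ` and
  `g·yᵢ` by a `C`-fixed edge `ε`, whose translate `g·ε` (from `g·yᵢ` to `g²·yᵢ`) is `C`-fixed as well;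
  `g·ε = ε` is excluded because the action is over `𝔾` (no branch switching, so `g` would fix `yᵢ`), and
  `g·ε ≠ ε` makes `yᵢ, g·yᵢ, g²·yᵢ` either the two ends of a double edge or — with `hadj` for `(y, g²·y)` —
  a triangle of the TREE `𝒢_{∞,i}` (`SemiGraph.edge_unique_of_abuts`, `SemiGraph.not_three_pairwise_joined`).
  Neither sentence of Thm 3.7 (iii) is used.
* `centralizer_le_verticial_of_isLocallyFinite` — for `𝒢` satisfying the hypotheses of Thm 3.7 with
  LOCALLY FINITE underlying semi-graph, EVERY chart, every compact `C ≠ 1` and every verticial `H ⊇ C`: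
  `centralizer C ≤ H` (the canonical `hadj` of abc-iut-w6-d062's `hadj_temperedPiChart_of_isLocallyFinite`,
  transported along `TemperedPiChart.exists_compatIso` / `VerticialLevelData.transport` /
  `VerticialLevelData.hadj_transport`); `centralizer_le_verticial_of_finite` — the same at a finite `𝔾`.
* `edgeLikeCentralizerAt_of_isLocallyFinite` — **(R3c) `EdgeLikeCentralizerAt ℋ c` (F-2772) at EVERY
  locally finite graph of anabelioids `ℋ` satisfying the hypotheses of Cor. 3.9 and EVERY chart, LOOPS
  INCLUDED** (the open piece `ψ(U)` is compact and nontrivial: abc-iut-f-176's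
  `isCompact_map_and_ne_bot_of_isEdgeHom`); in particular at the ray `𝒢_θ` of the programme REFUTE-F1732,
  where the first sentence of Thm 3.7 (iii) fails.  This removes both residual hypotheses of
  abc-iut-f-176's `centralizer_map_le_of_twoHostsAt_of_noSwapAt` at locally finite graphs
  (`noSwapAt_of_isLocallyFinite` records the «no swap» clause in that shape).
* `edgeLikeCentralizer_of_isLocallyFinite` — the frozen ∀-fact F-2773 RESTRICTED to locally finite graphs,
  hypothesis-free; `edgeLikeCentralizer_of_hadj` — the bare ∀-fact re-bound to the (FIX∞).hadj clause at the
  canonical towers (the cell's residual G-t6g3-2b, open only at vertices of infinite valence) instead of the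
  first sentence of Thm 3.7 (iii) (kernel-refuted as a ∀-countable statement, `not_compactInVerticial`).

Honest framing: statements about OUR typed tempered fundamental groups; the bare ∀-closure of F-2773 over
graphs with vertices of infinite valence is NOT claimed; cone-irrelevant beyond finite dual graphs (where
(R3c) was already `edgeLikeCentralizerAt_of_finiteGraph`); no side taken on [IUTchIII] Cor. 3.12; typed ≠
proved elsewhere.
-/

namespace Literature.AnabelianGeometry.SemiGraphs

namespace ProfiniteSemiGraph

open CategoryTheory Topology

universe v u

namespace VerticialLevelData

variable {𝒢 : ProfiniteSemiGraph.{u}} {c : TemperedPiChart 𝒢} (D : VerticialLevelData.{v} 𝒢 c)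

/-! ### Bookkeeping for the action through `Aut (tree j)` -/

/-- The action of a product on a vertex of `𝒢_{∞,j}`. [cite: MochizukiSemiAnbd2006, Thm 3.7(iii) p.41] -/
private theorem act_mul_vertexMap (j : D.J) (a b : c.G) (y : (D.tree j).Vertex) :
    (D.act j (a * b)).hom.vertexMap y = (D.act j a).hom.vertexMap ((D.act j b).hom.vertexMap y) := by
  rw [map_mul]; rfl

/-- The action of a product on an edge of `𝒢_{∞,j}`. [cite: MochizukiSemiAnbd2006, Thm 3.7(iii) p.41] -/
private theorem act_mul_edgeMap (j : D.J) (a b : c.G) (ε : (D.tree j).Edge) :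
    (D.act j (a * b)).hom.edgeMap ε = (D.act j a).hom.edgeMap ((D.act j b).hom.edgeMap ε) := by
  rw [map_mul]; rfl

/-- The action of `1` on a vertex of `𝒢_{∞,j}`. [cite: MochizukiSemiAnbd2006, Thm 3.7(iii) p.41] -/
private theorem act_one_vertexMap (j : D.J) (y : (D.tree j).Vertex) : (D.act j 1).hom.vertexMap y = y := by
  rw [map_one]; rfl

/-- Each `g` acts injectively on the vertices of `𝒢_{∞,j}`. [cite: MochizukiSemiAnbd2006, Thm 3.7(iii) p.41] -/
private theorem act_vertexMap_injective (j : D.J) (g : c.G) :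
    Function.Injective (D.act j g).hom.vertexMap := by
  intro y₁ y₂ h
  have h' := congrArg (D.act j g⁻¹).hom.vertexMap h
  rwa [← D.act_mul_vertexMap, ← D.act_mul_vertexMap, inv_mul_cancel, D.act_one_vertexMap,
    D.act_one_vertexMap] at h'

/-- The translate `g·x` of a compatible vertex system is compatible (equivariance of the transition maps).
[cite: MochizukiSemiAnbd2006, Thm 3.7(iii) p.41] -/
private theorem translate_compat (g : c.G) {x : ∀ j, (D.tree j).Vertex}
    (hx : ∀ ⦃i j : D.J⦄ (h : i ≤ j), (D.trans h).vertexMap (x j) = x i) :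
    ∀ ⦃i j : D.J⦄ (h : i ≤ j),
      (D.trans h).vertexMap ((D.act j g).hom.vertexMap (x j)) = (D.act i g).hom.vertexMap (x i) := by
  intro i j h
  rw [D.trans_act_vertexMap, hx h]

/-- If `g` commutes with `C`, the translate `g·x` of a `C`-fixed vertex system is `C`-fixed.
[cite: MochizukiSemiAnbd2006, Thm 3.7(iii) p.41] -/
private theorem translate_fixed {C : Subgroup c.G} {g : c.G} (hcomm : ∀ k ∈ C, k * g = g * k)
    {x : ∀ j, (D.tree j).Vertex} (hx : ∀ k ∈ C, ∀ j, (D.act j k).hom.vertexMap (x j) = x j) :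
    ∀ k ∈ C, ∀ j, (D.act j k).hom.vertexMap ((D.act j g).hom.vertexMap (x j)) =
      (D.act j g).hom.vertexMap (x j) := by
  intro k hk j
  rw [← D.act_mul_vertexMap, hcomm k hk, D.act_mul_vertexMap, hx k hk j]

/-! ### The centraliser of `C` lies in every verticial host of `C`, from the adjacency clause of (FIX∞) -/

/-- **Centralisers lie in the verticial hosts, from the adjacency of compatible fixed systems** ([SemiAnbd]
Thm 3.7 (iii) p. 41 "if `H` fixes two vertices of `𝒢_{∞,j}`, then these two vertices are joined to one another
by a single edge"; Cor. 3.9 p. 43 l. 13): over the level data `D` of a chart `c`, let `C ≤ π₁^temp(𝒢)` satisfy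
the adjacency clause `hadj` (any two compatible `C`-fixed vertex systems that differ at a level are the two ends
of a `C`-fixed edge there).  Then for every verticial subgroup `H ⊇ C`, the centraliser of `C` lies in `H`.
Route: `H` fixes a compatible system `y` (I1), and `H` is the full stabiliser of `y` ((I2), Thm 3.7 (ii) via
`eq_of_le_of_mem_verticialSubgroups`); for `g` centralising `C`, `g·y` is `C`-fixed; if `g·yᵢ ≠ yᵢ`, the
`C`-fixed edge `ε : yᵢ — g·yᵢ` of `hadj` has the `C`-fixed translate `g·ε : g·yᵢ — g²·yᵢ`; `g·ε = ε` would make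
`g` fix `yᵢ` (the action is over `𝔾`: `branchMap_eq_of_edgeMap_eq`); `g·ε ≠ ε` contradicts the tree
`𝒢_{∞,i}`: if `g²·yᵢ = yᵢ` the two edges join the same two vertices (`SemiGraph.edge_unique_of_abuts`), else
`hadj` for `(y, g²·y)` closes a triangle (`SemiGraph.not_three_pairwise_joined`).  Neither sentence of
Thm 3.7 (iii) is used. [cite: MochizukiSemiAnbd2006, Thm 3.7(iii) p.41] -/
theorem centralizer_le_of_hadj (hVD : VerticialDistinct.{u}) (h𝒢 : 𝒢.Thm37Hypotheses) (C : Subgroup c.G)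
    (hadj : ∀ x x' : ∀ j, (D.tree j).Vertex,
      (∀ ⦃i j : D.J⦄ (h : i ≤ j), (D.trans h).vertexMap (x j) = x i) →
      (∀ ⦃i j : D.J⦄ (h : i ≤ j), (D.trans h).vertexMap (x' j) = x' i) →
      (∀ g ∈ C, ∀ j, (D.act j g).hom.vertexMap (x j) = x j) →
      (∀ g ∈ C, ∀ j, (D.act j g).hom.vertexMap (x' j) = x' j) →
      ∀ j, x j ≠ x' j → ∃ (e : (D.tree j).Edge) (b b' : (D.tree j).Branch), b ≠ b' ∧
        (D.tree j).edgeOf b = e ∧ (D.tree j).edgeOf b' = e ∧ (D.tree j).abuts b = some (x j) ∧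
        (D.tree j).abuts b' = some (x' j) ∧ ∀ g ∈ C, (D.act j g).hom.edgeMap e = e)
    {v : 𝒢.graph.Vertex} {H : Subgroup c.G} (hH : H ∈ verticialSubgroups c v) (hCH : C ≤ H) :
    Subgroup.centralizer (C : Set c.G) ≤ H := by
  classical
  -- (I1): `H`, hence `C`, fixes a compatible system `y`
  obtain ⟨y, hyc, hyf⟩ := D.fix v H hH
  have hyC : ∀ k ∈ C, ∀ j, (D.act j k).hom.vertexMap (y j) = y j := fun k hk j => hyf k (hCH hk) j
  -- (I2) with Thm 3.7 (ii): `H` is the full stabiliser of `y`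
  obtain ⟨v', H', hH', hstab⟩ := D.stab y hyc
  have hHH' : H = H' :=
    eq_of_le_of_mem_verticialSubgroups hVD h𝒢 c hH hH' fun g hg => hstab g (hyf g hg)
  intro g hg
  have hcomm : ∀ k ∈ C, k * g = g * k := fun k hk => Subgroup.mem_centralizer_iff.mp hg k hk
  -- the translate `g·y`: compatible and `C`-fixed
  have hy'c := D.translate_compat g hyc
  have hy'C := D.translate_fixed hcomm hyC
  -- if `g` fixes `y` at every level, `g ∈ Stab(y) = H`
  by_cases hgy : ∀ j, (D.act j g).hom.vertexMap (y j) = y j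
  · rw [hHH']
    exact hstab g hgy
  exfalso
  obtain ⟨i, hi⟩ := not_forall.mp hgy
  -- `hadj` at level `i` for `(y, g·y)`: a `C`-fixed edge `ε : y i — g·y i`
  obtain ⟨ε, β, β', -, hβε, hβ'ε, hβy, hβ'y', hεC⟩ :=
    hadj y (fun j => (D.act j g).hom.vertexMap (y j)) hyc hy'c hyC hy'C i (Ne.symm hi)
  -- its translate `g·ε : g·y i — g²·y i` is `C`-fixed
  have hgεC : ∀ k ∈ C, (D.act i k).hom.edgeMap ((D.act i g).hom.edgeMap ε) = (D.act i g).hom.edgeMap ε := by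
    intro k hk
    rw [← D.act_mul_edgeMap, hcomm k hk, D.act_mul_edgeMap, hεC k hk]
  -- `g·ε ≠ ε`: otherwise `g` fixes the branch `β` of `ε` (the action is over `𝔾`), hence `y i`
  have hgε : (D.act i g).hom.edgeMap ε ≠ ε := by
    intro h
    have hb : (D.act i g).hom.branchMap β = β :=
      D.branchMap_eq_of_edgeMap_eq i g β (by rw [hβε]; exact h)
    have hab := (D.act i g).hom.abuts_branchMap β (y i) hβy
    rw [hb, hβy] at hab
    exact hi (Option.some_injective _ hab).symm
  -- the branches of `g·ε`: `g·β` at `g·y i`, `g·β'` at `g²·y i`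
  have hgβε : (D.tree i).edgeOf ((D.act i g).hom.branchMap β) = (D.act i g).hom.edgeMap ε := by
    rw [(D.act i g).hom.edgeOf_branchMap, hβε]
  have hgβ'ε : (D.tree i).edgeOf ((D.act i g).hom.branchMap β') = (D.act i g).hom.edgeMap ε := by
    rw [(D.act i g).hom.edgeOf_branchMap, hβ'ε]
  have hgβy' : (D.tree i).abuts ((D.act i g).hom.branchMap β) =
      some ((D.act i g).hom.vertexMap (y i)) :=
    (D.act i g).hom.abuts_branchMap β (y i) hβy
  have hgβ'y'' : (D.tree i).abuts ((D.act i g).hom.branchMap β') =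
      some ((D.act i g).hom.vertexMap ((D.act i g).hom.vertexMap (y i))) :=
    (D.act i g).hom.abuts_branchMap β' _ hβ'y'
  -- the second translate `g²·y = g·(g·y)`: compatible and `C`-fixed
  have hy''c := D.translate_compat g hy'c
  have hy''C := D.translate_fixed hcomm hy'C
  by_cases heq : y i = (D.act i g).hom.vertexMap ((D.act i g).hom.vertexMap (y i))
  · -- `g²·y i = y i`: then `ε` and `g·ε` both join `y i` and `g·y i`, so they coincide in the tree
    refine hgε (SemiGraph.edge_unique_of_abuts (D.isTree i) (Ne.symm hi) hβε hβ'ε hgβ'ε hgβε hβy hβ'y'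
      ?_ hgβy').symm
    rw [hgβ'y'', ← heq]
  · -- `g²·y i ≠ y i`: `hadj` joins them too, and `y i, g·y i, g²·y i` is a triangle of the tree `𝒢_{∞,i}`
    have hne₂ : (D.act i g).hom.vertexMap (y i) ≠
        (D.act i g).hom.vertexMap ((D.act i g).hom.vertexMap (y i)) :=
      fun h => hi (D.act_vertexMap_injective i g h).symm
    obtain ⟨ε₃, β₃, β₃', -, hβ₃ε, hβ₃'ε, hβ₃y, hβ₃'y'', -⟩ :=
      hadj y (fun j => (D.act j g).hom.vertexMap ((D.act j g).hom.vertexMap (y j))) hyc hy''c hyC hy''C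
        i heq
    exact SemiGraph.not_three_pairwise_joined (D.isTree i) (Ne.symm hi) hne₂ heq hβε hβ'ε hβy hβ'y'
      hgβε hgβ'ε hgβy' hgβ'y'' hβ₃ε hβ₃'ε hβ₃y hβ₃'y''

end VerticialLevelData

/-! ### At every locally finite countable `𝒢`: every chart, every nontrivial compact subgroup -/

variable (𝒢 : ProfiniteSemiGraph.{u}) {ℋ : ProfiniteSemiGraph.{u}}

/-- **The centraliser of a nontrivial compact subgroup of `π₁^temp(𝒢)` lies in each of its verticial hosts,
at every LOCALLY FINITE countable `𝒢`** satisfying the hypotheses of [SemiAnbd] Thm 3.7, for EVERY chart `c`: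
for `C ≤ c.G` compact, `C ≠ 1`, and every verticial subgroup `H ⊇ C`, `centralizer C ≤ H`.  The adjacency
clause of (FIX∞) is abc-iut-w6-d062's `hadj_temperedPiChart_of_isLocallyFinite` at the canonical tower,
transported to the level data of `c` (`TemperedPiChart.exists_compatIso`, `VerticialLevelData.transport`,
`VerticialLevelData.hadj_transport`); then `VerticialLevelData.centralizer_le_of_hadj` with Thm 3.7 (ii)
`verticialDistinct_holds`.  Neither sentence of Thm 3.7 (iii) is used (the first one fails at such graphs,
`not_compactInVerticial`). [cite: MochizukiSemiAnbd2006, Thm 3.7(iii) pp.40-41] -/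
theorem centralizer_le_verticial_of_isLocallyFinite (h37 : 𝒢.Thm37Hypotheses)
    (hlf : 𝒢.graph.IsLocallyFinite) (c : TemperedPiChart 𝒢) (C : Subgroup c.G)
    (hCc : IsCompact (C : Set c.G)) (hC : C ≠ ⊥) {v : 𝒢.graph.Vertex} {H : Subgroup c.G}
    (hH : H ∈ verticialSubgroups c v) (hCH : C ≤ H) :
    Subgroup.centralizer (C : Set c.G) ≤ H := by
  obtain ⟨φ, ψ, hψφ, hφψ, hφ, hψ⟩ :=
    TemperedPiChart.exists_compatIso (𝒢.temperedPiChart h37.toProp36Hypotheses) c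
  let D₀ := verticialLevelData_temperedPiChart (h36 := h37.toProp36Hypotheses)
  let D : VerticialLevelData.{0} 𝒢 c := D₀.transport φ ψ hψφ hφψ
    (fun v H => mem_verticialSubgroups_iff_map φ hφ ψ hφψ hψ H)
    (fun e L => mem_edgeLikeSubgroups_iff_map φ hφ ψ hφψ hψ L)
  exact D.centralizer_le_of_hadj verticialDistinct_holds h37 C
    (D₀.hadj_transport φ ψ hψφ hφψ _ _
      (fun C' hC'c hC' x x' hx hx' hfx hfx' j hne' =>
        𝒢.hadj_temperedPiChart_of_isLocallyFinite h37 hlf C' hC'c hC' x x' hx hx' hfx hfx' j hne') C hCc hC)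
    hH hCH

/-- A finite semi-graph is locally finite. [cite: MochizukiSemiAnbd2006, §1 p.13] -/
private theorem isLocallyFinite_of_finite (G : SemiGraph.{u}) [Finite G.Edge] : G.IsLocallyFinite :=
  ⟨fun _ => Set.toFinite _⟩

/-- **The same at a FINITE `𝔾`** (the case of every dual semi-graph in [IUTchI–IV]): for `𝒢` satisfying the
hypotheses of Thm 3.7 with finitely many edges, every chart, every compact `C ≠ 1` and every verticial
`H ⊇ C`, `centralizer C ≤ H`. [cite: MochizukiSemiAnbd2006, Thm 3.7(iii) pp.40-41] -/
theorem centralizer_le_verticial_of_finite (h37 : 𝒢.Thm37Hypotheses) [Finite 𝒢.graph.Edge]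
    (c : TemperedPiChart 𝒢) (C : Subgroup c.G) (hCc : IsCompact (C : Set c.G)) (hC : C ≠ ⊥)
    {v : 𝒢.graph.Vertex} {H : Subgroup c.G} (hH : H ∈ verticialSubgroups c v) (hCH : C ≤ H) :
    Subgroup.centralizer (C : Set c.G) ≤ H :=
  𝒢.centralizer_le_verticial_of_isLocallyFinite h37 (isLocallyFinite_of_finite 𝒢.graph) c C hCc hC hH hCH

/-! ### (R3c) `EdgeLikeCentralizerAt` at every locally finite graph of Cor 3.9 — loops included -/

/-- **(R3c) F-2772 `EdgeLikeCentralizerAt ℋ c` at every LOCALLY FINITE graph of anabelioids `ℋ` satisfying the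
hypotheses of [SemiAnbd] Cor. 3.9, for EVERY chart — loops included** (p. 43 l. 13 "[again by Theorem 3.7,
(iii), (iv)]"): the centraliser in `π₁^temp(ℋ)` of the image `ψ(U)` of an open `U ⊆ Π_e` under an edge
homomorphism `ψ` at `e` lies in every verticial subgroup containing `ψ(U)` — `ψ(U)` being a nontrivial compact
subgroup (abc-iut-f-176's `isCompact_map_and_ne_bot_of_isEdgeHom`: `Π_e` is infinite by total aloofness at an
elevated end-vertex, `ψ` injective by Thm 3.7 (i)).  Covers the ray `𝒢_θ` of the programme REFUTE-F1732.
[cite: MochizukiSemiAnbd2006, Cor 3.9 p.43] -/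
theorem edgeLikeCentralizerAt_of_isLocallyFinite (hℋ : Cor39Hypotheses ℋ) (hlf : ℋ.graph.IsLocallyFinite)
    (c : TemperedPiChart ℋ) : EdgeLikeCentralizerAt ℋ c := by
  intro e ψ hψ U hU v H hH hUH
  obtain ⟨hCc, hC⟩ := isCompact_map_and_ne_bot_of_isEdgeHom hℋ c e ψ hψ U hU
  exact ℋ.centralizer_le_verticial_of_isLocallyFinite hℋ.thm37Hypotheses hlf c _ hCc hC hH hUH

/-- **«No swap» at every locally finite graph of Cor 3.9**, in the shape of hypothesis (b) of abc-iut-f-176's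
`centralizer_map_le_of_twoHostsAt_of_noSwapAt`: no `ψ(U)`-centralising element conjugates a verticial host of
`ψ(U)` onto a different host (at the same vertex or not) — such an element lies in the host, which is fixed by
conjugation by its own elements. [cite: MochizukiSemiAnbd2006, Cor 3.9 p.43] -/
theorem noSwapAt_of_isLocallyFinite (hℋ : Cor39Hypotheses ℋ) (hlf : ℋ.graph.IsLocallyFinite)
    (c : TemperedPiChart ℋ) (e : ℋ.graph.Edge) (ψ : ℋ.Ge e →ₜ* c.G) (hψ : IsEdgeHom c e ψ)
    (U : Subgroup (ℋ.Ge e)) (hU : IsOpen (U : Set (ℋ.Ge e))) :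
    ∀ g ∈ Subgroup.centralizer ((U.map ψ.toMonoidHom : Subgroup c.G) : Set c.G),
      ∀ (w : ℋ.graph.Vertex) (H₁ H₂ : Subgroup c.G), H₁ ∈ verticialSubgroups c w →
        H₂ ∈ verticialSubgroups c w → H₁ ≠ H₂ → U.map ψ.toMonoidHom ≤ H₁ → U.map ψ.toMonoidHom ≤ H₂ →
          H₁.map (MulAut.conj g).toMonoidHom ≠ H₂ := by
  intro g hg w H₁ H₂ hH₁ _ hne hC₁ _ h12
  obtain ⟨hCc, hC⟩ := isCompact_map_and_ne_bot_of_isEdgeHom hℋ c e ψ hψ U hU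
  have hg₁ : g ∈ H₁ := ℋ.centralizer_le_verticial_of_isLocallyFinite hℋ.thm37Hypotheses hlf c _ hCc hC hH₁ hC₁ hg
  refine hne ?_
  rw [← h12]
  ext x
  simp only [Subgroup.mem_map, MulEquiv.coe_toMonoidHom, MulAut.conj_apply]
  constructor
  · intro hx
    exact ⟨g⁻¹ * x * g, H₁.mul_mem (H₁.mul_mem (H₁.inv_mem hg₁) hx) hg₁, by group⟩
  · rintro ⟨y, hy, rfl⟩
    exact H₁.mul_mem (H₁.mul_mem hg₁ hy) (H₁.inv_mem hg₁)

/-! ### The frozen ∀-fact F-2773: restricted to locally finite graphs, and re-bound to (FIX∞).hadj -/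

/-- **F-2773 `EdgeLikeCentralizer` RESTRICTED to locally finite graphs, hypothesis-free**: for every locally
finite graph of anabelioids satisfying the hypotheses of [SemiAnbd] Cor. 3.9 and every chart,
`EdgeLikeCentralizerAt`.  (The bare ∀-countable fact additionally ranges over graphs with vertices of infinite
valence, where the adjacency clause of (FIX∞) is the cell's open residual G-t6g3-2b; see
`edgeLikeCentralizer_of_hadj`.) [cite: MochizukiSemiAnbd2006, Cor 3.9 p.43] -/
theorem edgeLikeCentralizer_of_isLocallyFinite :
    ∀ (ℋ : ProfiniteSemiGraph.{u}), Cor39Hypotheses ℋ → ℋ.graph.IsLocallyFinite →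
      ∀ (c : TemperedPiChart ℋ), EdgeLikeCentralizerAt ℋ c :=
  fun _ hℋ hlf c => edgeLikeCentralizerAt_of_isLocallyFinite hℋ hlf c

/-- **F-2773 `EdgeLikeCentralizer` from the adjacency clause of (FIX∞) at the canonical towers ALONE**: if for
every graph of anabelioids `ℋ` satisfying the hypotheses of Thm 3.7 any two compatible vertex systems of the
trees `𝔾̃_n` of the canonical tower fixed by a compact `C ≠ 1` are, where they differ, the two ends of a `C`-fixed
edge (print p. 41 "joined to one another by a single edge"; a theorem at locally finite `𝔾`,
`hadj_temperedPiChart_of_isLocallyFinite`), then `EdgeLikeCentralizer` — the first sentence of Thm 3.7 (iii)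
(bound by the tree's earlier producer `edgeLikeCentralizer_of_compactInVerticialAt_cor39`, refuted as a
∀-countable statement by `not_compactInVerticial`) is no longer needed. [cite: MochizukiSemiAnbd2006, Cor 3.9 p.43] -/
theorem edgeLikeCentralizer_of_hadj
    (Hadj : ∀ (ℋ : ProfiniteSemiGraph.{u}) (h37 : ℋ.Thm37Hypotheses)
      (C : Subgroup (ℋ.temperedPiChart h37.toProp36Hypotheses).G),
      IsCompact (C : Set (ℋ.temperedPiChart h37.toProp36Hypotheses).G) → C ≠ ⊥ →
      ∀ x x' : ∀ j, ((verticialLevelData_temperedPiChart (h36 := h37.toProp36Hypotheses)).tree j).Vertex,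
      (∀ ⦃i j : ℕ⦄ (hij : i ≤ j),
        ((verticialLevelData_temperedPiChart (h36 := h37.toProp36Hypotheses)).trans hij).vertexMap (x j) = x i) →
      (∀ ⦃i j : ℕ⦄ (hij : i ≤ j),
        ((verticialLevelData_temperedPiChart (h36 := h37.toProp36Hypotheses)).trans hij).vertexMap (x' j) = x' i) →
      (∀ g ∈ C, ∀ j,
        ((verticialLevelData_temperedPiChart (h36 := h37.toProp36Hypotheses)).act j g).hom.vertexMap (x j) = x j) →
      (∀ g ∈ C, ∀ j,
        ((verticialLevelData_temperedPiChart (h36 := h37.toProp36Hypotheses)).act j g).hom.vertexMap (x' j) = x' j) →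
      ∀ j, x j ≠ x' j →
        ∃ (e : ((verticialLevelData_temperedPiChart (h36 := h37.toProp36Hypotheses)).tree j).Edge)
          (b b' : ((verticialLevelData_temperedPiChart (h36 := h37.toProp36Hypotheses)).tree j).Branch), b ≠ b' ∧
          ((verticialLevelData_temperedPiChart (h36 := h37.toProp36Hypotheses)).tree j).edgeOf b = e ∧
          ((verticialLevelData_temperedPiChart (h36 := h37.toProp36Hypotheses)).tree j).edgeOf b' = e ∧
          ((verticialLevelData_temperedPiChart (h36 := h37.toProp36Hypotheses)).tree j).abuts b = some (x j) ∧
          ((verticialLevelData_temperedPiChart (h36 := h37.toProp36Hypotheses)).tree j).abuts b' = some (x' j) ∧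
          ∀ g ∈ C, ((verticialLevelData_temperedPiChart (h36 := h37.toProp36Hypotheses)).act j g).hom.edgeMap e = e) :
    Literature.AnabelianGeometry.SemiGraphs.ProfiniteSemiGraph.EdgeLikeCentralizer.{u} := by
  intro ℋ hℋ c e ψ hψ U hU v H hH hUH
  have h37 : ℋ.Thm37Hypotheses := hℋ.thm37Hypotheses
  obtain ⟨hCc, hC⟩ := isCompact_map_and_ne_bot_of_isEdgeHom hℋ c e ψ hψ U hU
  obtain ⟨φ, ψ', hψφ, hφψ, hφ, hψ'⟩ :=
    TemperedPiChart.exists_compatIso (ℋ.temperedPiChart h37.toProp36Hypotheses) c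
  let D₀ := verticialLevelData_temperedPiChart (𝒢 := ℋ) (h36 := h37.toProp36Hypotheses)
  let D : VerticialLevelData.{0} ℋ c := D₀.transport φ ψ' hψφ hφψ
    (fun v H => mem_verticialSubgroups_iff_map φ hφ ψ' hφψ hψ' H)
    (fun e L => mem_edgeLikeSubgroups_iff_map φ hφ ψ' hφψ hψ' L)
  exact D.centralizer_le_of_hadj verticialDistinct_holds h37 _
    (D₀.hadj_transport φ ψ' hψφ hφψ _ _ (fun C' hC'c hC' x x' hx hx' hfx hfx' j hne' =>
      Hadj ℋ h37 C' hC'c hC' x x' hx hx' hfx hfx' j hne') _ hCc hC) hH hUH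

end ProfiniteSemiGraph

end Literature.AnabelianGeometry.SemiGraphs
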